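import Summits.SmoothPoincare4.SmoothPoincare4.Theorems.RootDecompAEDoublesBeyondShadowTwoLedgerBlockSeg

/-!
# Grade-four ownership ledger `LocalTableLE4 → GradeFourDichotomy` for KMN encoding graphs, part 15/15: the assembly, II, and the registered stub

§14b `blocks_seg` (the blocks of a structural certificate in order) and §15 `theorem stub_ledgerFour : LedgerFour` —
assume `LocalTableLE4`; one-letter relators first, then the pieces in peeling order.

THE FAMILY (14 modules `Theorems/RootDecompAEDoublesBeyondShadowTwoLedger*.lean` + the closing module
`Theorems/RootDecompAEDoublesBeyondShadowTwoStubLedgerFour.lean`, one namespace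
`Summit.SmoothPoincare4.SmoothPoincare4.Theorems.RootDecompAEDoublesBeyondShadowTwoStubLedgerFour`, linearly chained
imports, split by topic to respect the 400-line bound on proof files).
-/

open Function
open Literature.Topology.FourManifolds

set_option linter.dupNamespace false

noncomputable section

namespace Summit.SmoothPoincare4.SmoothPoincare4.Theorems.RootDecompAEDoublesBeyondShadowTwoStubLedgerFour

namespace ShadowGraph

variable {G₄ : ShadowGraph}

/-- **THE BLOCKS.**  The blocks of a structural certificate, processed in order, form a valid segment from any
killing state whose eliminated letters are exactly the stable letters, the unused letters and the letters of the
pieces `Done` eliminated before, and whose used relators are the one-letter relators and the relators of rows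
`Used` disjoint from the owned rows; it ends in the corresponding state for `Done ∪ pieces(bs)` and
`Used ∪ owned rows`. -/
theorem blocks_seg (hself : ∀ e, (G₄.src e).1 ≠ (G₄.tgt e).1) (hI : G₄.PortsInjective) {n : ℕ} (eg : G₄.Gen ≃ Fin n)
    (er : G₄.Rel ≃ Fin n) :
    ∀ (bs : List (Fin G₄.k × Finset (Fin G₄.m))) (Done : Finset (Fin G₄.k)) (Used : Fin G₄.m → Prop) (st : Roe.State n),
      G₄.BlocksOK Done bs → (bs.map Prod.fst).Nodup → (∀ b ∈ bs, b.1 ∉ Done) →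
      bs.Pairwise (fun b b' => Disjoint b.2 b'.2) → (∀ b ∈ bs, ∀ e ∈ b.2, ¬ Used e) →
      Roe.Kills st.1 st.2.1 →
      (∀ y, y ∈ st.2.1 ↔ (∃ e, y = eg (Sum.inr e)) ∨
        (∃ p : Fin G₄.k × Fin 5, (G₄.piece p.1).rank ≤ (p.2 : ℕ) ∧ y = eg (Sum.inl p)) ∨
          ∃ w ∈ Done, ∃ i, y = eg (Sum.inl (w, i))) →
      (∀ r, r ∈ st.2.2 ↔ (∃ x, r = er (Sum.inr x)) ∨ ∃ e, Used e ∧ r = er (Sum.inl e)) →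
      ∃ seg : List (Roe.Step n), Roe.SegValid (G₄.presentation eg er) seg st ∧
        Roe.Kills (Roe.endState seg st).1 (Roe.endState seg st).2.1 ∧
        (∀ y, y ∈ (Roe.endState seg st).2.1 ↔ (∃ e, y = eg (Sum.inr e)) ∨
          (∃ p : Fin G₄.k × Fin 5, (G₄.piece p.1).rank ≤ (p.2 : ℕ) ∧ y = eg (Sum.inl p)) ∨
            ∃ w, (w ∈ Done ∨ w ∈ bs.map Prod.fst) ∧ ∃ i, y = eg (Sum.inl (w, i))) ∧
        (∀ r, r ∈ (Roe.endState seg st).2.2 ↔ (∃ x, r = er (Sum.inr x)) ∨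
          ∃ e, (Used e ∨ ∃ b ∈ bs, e ∈ b.2) ∧ r = er (Sum.inl e)) := by
  classical
  intro bs
  induction bs with
  | nil =>
    intro Done Used st _ _ _ _ _ hK hE hU
    refine ⟨[], Roe.segValid_nil₄, ?_, ?_, ?_⟩
    · rw [Roe.endState_nil₄]; exact hK
    · rw [Roe.endState_nil₄]
      intro y
      rw [hE y]
      simp
    · rw [Roe.endState_nil₄]
      intro r
      rw [hU r]
      simp
  | cons b rest ih =>
    intro Done Used st hok hnd hnotDone hpw hUsed hK hE hU
    obtain ⟨v, own⟩ := b
    rw [blocksOK_cons₄] at hok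
    obtain ⟨hblk, ⟨ls, hcheck, hperm⟩, hrest⟩ := hok
    rw [List.map_cons, List.nodup_cons] at hnd
    obtain ⟨hvN, hnd'⟩ := hnd
    rw [List.pairwise_cons] at hpw
    obtain ⟨hdisj, hpw'⟩ := hpw
    have hvD : v ∉ Done := hnotDone (v, own) List.mem_cons_self
    -- the hypotheses of the piece block
    have hown : ∀ e ∈ own, (G₄.src e).1 = v ∨ (G₄.tgt e).1 = v := fun e he => (hblk e he).1
    have hfar : ∀ e ∈ own, ∀ i, eg (Sum.inl (G₄.other e v, i)) ∈ st.2.1 := fun e he i =>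
      (hE _).mpr (Or.inr (Or.inr ⟨G₄.other e v, (hblk e he).2, i, rfl⟩))
    have hstab : ∀ e ∈ own, eg (Sum.inr e) ∈ st.2.1 := fun e _ => (hE _).mpr (Or.inl ⟨e, rfl⟩)
    have hunused : ∀ i : Fin 5, (G₄.piece v).rank ≤ (i : ℕ) → G₄.gl eg v i ∈ st.2.1 := fun i hi =>
      (hE _).mpr (Or.inr (Or.inl ⟨(v, i), hi, rfl⟩))
    have hused : ∀ i : Fin 5, (i : ℕ) < (G₄.piece v).rank → G₄.gl eg v i ∉ st.2.1 := by
      intro i hi h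
      rw [hE] at h
      rcases h with ⟨e, h⟩ | ⟨p, hp, h⟩ | ⟨w, hw, i', h⟩
      · simp [gl] at h
      · simp only [gl, EmbeddingLike.apply_eq_iff_eq, Sum.inl.injEq] at h
        rw [← h] at hp
        exact absurd hi (not_lt.mpr hp)
      · simp only [gl, EmbeddingLike.apply_eq_iff_eq, Sum.inl.injEq, Prod.mk.injEq] at h
        exact hvD (h.1 ▸ hw)
    have hU₀ : ∀ e ∈ own, er (Sum.inl e) ∉ st.2.2 := by
      intro e he h
      rw [hU] at h
      rcases h with ⟨x, h⟩ | ⟨e', hue, h⟩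
      · simp at h
      · have : e = e' := Sum.inl_injective (er.injective h)
        subst this
        exact hUsed (v, own) List.mem_cons_self e he hue
    have hports : ∀ s ∈ ls, ∃ e ∈ own, G₄.uport e v = s.port := by
      intro s hs
      exact mem_uports₄.mp (hperm.mem_iff.mp (List.mem_map.mpr ⟨s, hs, rfl⟩))
    have hndp : (ls.map LStep.port).Nodup := hperm.nodup_iff.mpr (Finset.sort_nodup _ _)
    have hΦa : ∀ i, st.1 (FreeGroup.of (G₄.gl eg v i)) = FreeGroup.map (G₄.gl eg v) (linit (G₄.piece v) i) := by
      intro i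
      rw [hK]
      unfold linit
      by_cases hi : (G₄.piece v).rank ≤ (i : ℕ)
      · rw [if_pos (hunused i hi), if_pos hi, map_one]
      · rw [if_neg (hused i (not_le.mp hi)), if_neg hi, FreeGroup.map.of]
    have hΦb : ∀ y, (∀ i, y ≠ G₄.gl eg v i) → st.1 (FreeGroup.of y) = if y ∈ st.2.1 then 1 else FreeGroup.of y :=
      fun y _ => hK y
    have hEb : ∀ y, y ∈ st.2.1 ↔ y ∈ st.2.1 ∨ ∃ i ∈ lunused (G₄.piece v), y = G₄.gl eg v i := by
      intro y
      constructor
      · exact Or.inl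
      · rintro (h | ⟨i, hi, rfl⟩)
        · exact h
        · unfold lunused at hi
          rw [List.mem_filter, decide_eq_true_eq] at hi
          exact hunused i hi.2
    have hlun : ∀ i : Fin 5, (G₄.piece v).rank ≤ (i : ℕ) → i ∈ lunused (G₄.piece v) := by
      intro i hi
      unfold lunused
      rw [List.mem_filter, decide_eq_true_eq]
      exact ⟨List.mem_finRange i, hi⟩
    have hUb : ∀ r, r ∈ st.2.2 ↔ r ∈ st.2.2 ∨ ∃ e ∈ own, G₄.uport e v ∉ ls.map LStep.port ∧ r = er (Sum.inl e) := by
      intro r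
      constructor
      · exact Or.inl
      · rintro (h | ⟨e, he, hne, rfl⟩)
        · exact h
        · exact absurd (hperm.mem_iff.mpr (mem_uports₄.mpr ⟨e, he, rfl⟩)) hne
    obtain ⟨seg₁, hseg₁, hK₁, hE₁, hU₁⟩ := block_seg hself hI eg er v own hown st.2.1 st.2.2 hfar hstab hused hU₀
      ls (linit (G₄.piece v)) (lunused (G₄.piece v)) st hcheck hports hndp hΦa hΦb hEb hlun hUb
    -- the remaining blocks from the end state of the block of `v`
    have hnotDone' : ∀ b ∈ rest, b.1 ∉ insert v Done := by
      intro b hb h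
      rw [Finset.mem_insert] at h
      rcases h with h | h
      · exact hvN (h ▸ List.mem_map.mpr ⟨b, hb, rfl⟩)
      · exact hnotDone b (List.mem_cons_of_mem _ hb) h
    have hUsed' : ∀ b ∈ rest, ∀ e ∈ b.2, ¬ (Used e ∨ e ∈ own) := by
      intro b hb e he h
      rcases h with h | h
      · exact hUsed b (List.mem_cons_of_mem _ hb) e he h
      · exact Finset.disjoint_left.mp (hdisj b hb) h he
    have hE₁' : ∀ y, y ∈ (Roe.endState seg₁ st).2.1 ↔ (∃ e, y = eg (Sum.inr e)) ∨
        (∃ p : Fin G₄.k × Fin 5, (G₄.piece p.1).rank ≤ (p.2 : ℕ) ∧ y = eg (Sum.inl p)) ∨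
          ∃ w ∈ insert v Done, ∃ i, y = eg (Sum.inl (w, i)) := by
      intro y
      rw [hE₁ y, hE y]
      constructor
      · rintro ((h | h | ⟨w, hw, i, h⟩) | ⟨i, h⟩)
        · exact Or.inl h
        · exact Or.inr (Or.inl h)
        · exact Or.inr (Or.inr ⟨w, Finset.mem_insert_of_mem hw, i, h⟩)
        · exact Or.inr (Or.inr ⟨v, Finset.mem_insert_self v Done, i, h⟩)
      · rintro (h | h | ⟨w, hw, i, h⟩)
        · exact Or.inl (Or.inl h)
        · exact Or.inl (Or.inr (Or.inl h))
        · rcases Finset.mem_insert.mp hw with rfl | hw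
          · exact Or.inr ⟨i, h⟩
          · exact Or.inl (Or.inr (Or.inr ⟨w, hw, i, h⟩))
    have hU₁' : ∀ r, r ∈ (Roe.endState seg₁ st).2.2 ↔ (∃ x, r = er (Sum.inr x)) ∨
        ∃ e, (Used e ∨ e ∈ own) ∧ r = er (Sum.inl e) := by
      intro r
      rw [hU₁ r, hU r]
      constructor
      · rintro ((h | ⟨e, hue, h⟩) | ⟨e, he, h⟩)
        · exact Or.inl h
        · exact Or.inr ⟨e, Or.inl hue, h⟩
        · exact Or.inr ⟨e, Or.inr he, h⟩
      · rintro (h | ⟨e, hue | he, h⟩)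
        · exact Or.inl (Or.inl h)
        · exact Or.inl (Or.inr ⟨e, hue, h⟩)
        · exact Or.inr ⟨e, he, h⟩
    obtain ⟨seg₂, hseg₂, hK₂, hE₂, hU₂⟩ := ih (insert v Done) (fun e => Used e ∨ e ∈ own) (Roe.endState seg₁ st)
      hrest hnd' hnotDone' hpw' hUsed' hK₁ hE₁' hU₁'
    refine ⟨seg₁ ++ seg₂, Roe.seg_append₄ _ _ _ hseg₁ hseg₂, ?_, ?_, ?_⟩
    · rw [Roe.endState_append₄]; exact hK₂
    · rw [Roe.endState_append₄]
      intro y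
      rw [hE₂ y]
      simp only [Finset.mem_insert, List.map_cons, List.mem_cons]
      constructor
      · rintro (h | h | ⟨w, hw, i, h⟩)
        · exact Or.inl h
        · exact Or.inr (Or.inl h)
        · refine Or.inr (Or.inr ⟨w, ?_, i, h⟩); tauto
      · rintro (h | h | ⟨w, hw, i, h⟩)
        · exact Or.inl h
        · exact Or.inr (Or.inl h)
        · refine Or.inr (Or.inr ⟨w, ?_, i, h⟩); tauto
    · rw [Roe.endState_append₄]
      intro r
      rw [hU₂ r]
      simp only [List.mem_cons]
      constructor
      · rintro (h | ⟨e, he, h⟩)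
        · exact Or.inl h
        · refine Or.inr ⟨e, ?_, h⟩
          rcases he with (he | he) | ⟨b, hb, he⟩
          · exact Or.inl he
          · exact Or.inr ⟨(v, own), Or.inl rfl, he⟩
          · exact Or.inr ⟨b, Or.inr hb, he⟩
      · rintro (h | ⟨e, he, h⟩)
        · exact Or.inl h
        · refine Or.inr ⟨e, ?_, h⟩
          rcases he with he | ⟨b, rfl | hb, he⟩
          · exact Or.inl (Or.inl he)
          · exact Or.inl (Or.inr he)
          · exact Or.inr ⟨b, hb, he⟩

end ShadowGraph


/-! ## §15 The registered stub -/

/-- **`stub_ledgerFour` — THE GRADE-FOUR LEDGER `LocalTableLE4 → GradeFourDichotomy`, PROVED.**  Assume the local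
table hypothesis and let `G₄` be an admissible encoding graph whose presentation `P(G₄)` presents the trivial group:
(1) `H₁ = 0` makes the exponent table unimodular (`um_full₄`), so no gluing is a non-tree gluing
(`tree_eq_true_of_presentsTrivialGroup₄`: a non-tree stable letter would survive in the abelianisation) and the block
`(gluings) × (used letters)` is unimodular (`um_top₄`); (2) peeling the spanning tree leaf by leaf (`peel_rec`) assigns
to every piece a set of owned gluings whose local exponent minor is unimodular (`minor_unit_of_um₄`: the row signs
factor out and the block calculus' Laplace determinant is `Matrix.det`, `det_eq_matrix_det`), and THE LOCAL TABLE
(`localTable`: decidable certificates for the six vertex-free pieces; for a decorated block the hypothesis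
`LocalTableLE4` says the block calculus' `localCheck` passed, i.e. `roeSearch` found a one-occurrence elimination of
the cyclically reduced owned port words, and `roe_sound` — with the free-group semantics of the list calculus,
`toFG5_freeReduce`, `isConj_toFG5_cycReduce`, `isConj_toFG5_substitute`, `splitAt_spec`, `expSum_eq_expo` — turns that
run into a passing local check `lcheck`) converts local unimodularity into a local elimination order
(`localCert_of_um`); (3) the one-letter relators (tree stable letters, unused letters) are eliminated first
(`Roe.oneLetter_seg₄`), then the pieces in peeling order, each by its local certificate transported to the global
letters (`block_seg`, `blocks_seg`): after the far ends and the stable letter of an owned gluing are killed, its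
relator is the image of the local port word (`lift_rel_u₄`), so the local conjugacy `c · w^{±1} · c⁻¹ = x · W` becomes
the global step condition. -/
theorem stub_ledgerFour : LedgerFour := by
  classical
  intro hLT G₄ n eg er hA hAC
  obtain ⟨hV, hI, hT⟩ := hA
  have hall : ∀ e, G₄.tree e = true := G₄.tree_eq_true_of_presentsTrivialGroup₄ eg er hAC
  have hself : ∀ e, (G₄.src e).1 ≠ (G₄.tgt e).1 := fun e => hT.1 e (hall e)
  -- (2) the structural peeling certificate of the whole graph
  have hk : (Finset.univ : Finset (Fin G₄.k)).card = (G₄.k - 1) + 1 := by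
    have := hT.2.2
    rw [Finset.card_univ, Fintype.card_fin]
    omega
  obtain ⟨bs, hnd, hfst, hpw, hrows, hok⟩ := G₄.peel_rec hLT hV hI hT hall (G₄.k - 1) Finset.univ ∅ hk
    (Finset.disjoint_empty_right _) (G₄.induce_univ_connected₄ hT) (G₄.um_top₄ hall eg er hAC)
  -- (3a) the one-letter relators
  have hlt : Function.Injective fun x : {e : Fin G₄.m // G₄.tree e = true} ⊕
      {p : Fin G₄.k × Fin 5 // (G₄.piece p.1).rank ≤ (p.2 : ℕ)} => eg (G₄.ownLetter (Sum.inr x)) :=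
    fun x y h => ShadowGraph.ownLetter_inr_injective (eg.injective h)
  have hrl : Function.Injective fun x : {e : Fin G₄.m // G₄.tree e = true} ⊕
      {p : Fin G₄.k × Fin 5 // (G₄.piece p.1).rank ≤ (p.2 : ℕ)} => er (Sum.inr x) :=
    fun x y h => Sum.inr_injective (er.injective h)
  obtain ⟨hseg₀, hK₀, hE₀, hU₀⟩ := Roe.oneLetter_seg₄ (P := G₄.presentation eg er)
    (fun x => eg (G₄.ownLetter (Sum.inr x))) (fun x => er (Sum.inr x)) hlt hrl
    (fun x => ShadowGraph.presentation_inr eg er x) (Finset.univ.toList) (MonoidHom.id _, ∅, ∅)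
    (Finset.nodup_toList _) Roe.kills_id₄ (fun _ _ => by simp) (fun _ _ => by simp)
  -- (3b) the pieces in peeling order
  have hE₁ : ∀ y, y ∈ (Roe.endState (Finset.univ.toList.map fun x : {e : Fin G₄.m // G₄.tree e = true} ⊕
      {p : Fin G₄.k × Fin 5 // (G₄.piece p.1).rank ≤ (p.2 : ℕ)} =>
        (⟨er (Sum.inr x), eg (G₄.ownLetter (Sum.inr x)), 1, true⟩ : Roe.Step n)) (MonoidHom.id _, ∅, ∅)).2.1 ↔
      (∃ e, y = eg (Sum.inr e)) ∨ (∃ p : Fin G₄.k × Fin 5, (G₄.piece p.1).rank ≤ (p.2 : ℕ) ∧ y = eg (Sum.inl p)) ∨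
        ∃ w ∈ (∅ : Finset (Fin G₄.k)), ∃ i, y = eg (Sum.inl (w, i)) := by
    intro y
    rw [hE₀]
    simp only [Finset.empty_union, List.mem_toFinset, List.mem_map, Finset.mem_toList, Finset.mem_univ, true_and,
      Finset.notMem_empty, false_and, exists_false, or_false]
    constructor
    · rintro ⟨x, rfl⟩
      rcases x with ⟨e, he⟩ | ⟨p, hp⟩
      · exact Or.inl ⟨e, rfl⟩
      · exact Or.inr ⟨p, hp, rfl⟩
    · rintro (⟨e, rfl⟩ | ⟨p, hp, rfl⟩)
      · exact ⟨Sum.inl ⟨e, hall e⟩, rfl⟩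
      · exact ⟨Sum.inr ⟨p, hp⟩, rfl⟩
  have hU₁ : ∀ r, r ∈ (Roe.endState (Finset.univ.toList.map fun x : {e : Fin G₄.m // G₄.tree e = true} ⊕
      {p : Fin G₄.k × Fin 5 // (G₄.piece p.1).rank ≤ (p.2 : ℕ)} =>
        (⟨er (Sum.inr x), eg (G₄.ownLetter (Sum.inr x)), 1, true⟩ : Roe.Step n)) (MonoidHom.id _, ∅, ∅)).2.2 ↔
      (∃ x, r = er (Sum.inr x)) ∨ ∃ e, False ∧ r = er (Sum.inl e) := by
    intro r
    rw [hU₀]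
    simp only [Finset.empty_union, List.mem_toFinset, List.mem_map, Finset.mem_toList, Finset.mem_univ, true_and,
      false_and, exists_false, or_false]
    exact ⟨fun ⟨x, h⟩ => ⟨x, h.symm⟩, fun ⟨x, h⟩ => ⟨x, h.symm⟩⟩
  obtain ⟨seg₁, hseg₁, -, hE₂, hU₂⟩ := ShadowGraph.blocks_seg hself hI eg er bs ∅ (fun _ => False) _ hok hnd
    (fun _ _ => Finset.notMem_empty _) hpw (fun _ _ _ _ h => h) hK₀ hE₁ hU₁
  refine Roe.hasCertificate_of_seg₄ _ (Roe.seg_append₄ _ _ _ hseg₀ hseg₁) ?_ ?_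
  · rw [Roe.endState_append₄]
    refine Finset.eq_univ_of_forall fun y => (hE₂ y).mpr ?_
    obtain ⟨g, rfl⟩ := eg.surjective y
    rcases g with ⟨w, i⟩ | e
    · exact Or.inr (Or.inr ⟨w, Or.inr ((hfst w).mpr (Finset.mem_univ w)), i, rfl⟩)
    · exact Or.inl ⟨e, rfl⟩
  · rw [Roe.endState_append₄]
    refine Finset.eq_univ_of_forall fun r => (hU₂ r).mpr ?_
    obtain ⟨ρ, rfl⟩ := er.surjective r
    rcases ρ with e | x
    · refine Or.inr ⟨e, Or.inr ((hrows e).mp ?_), rfl⟩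
      rw [ShadowGraph.rows_univ₄]
      exact Finset.mem_univ e
    · exact Or.inl ⟨x, rfl⟩

end Summit.SmoothPoincare4.SmoothPoincare4.Theorems.RootDecompAEDoublesBeyondShadowTwoStubLedgerFour
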